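import Summits.QuantumAdvantage.QuantumAdvantage.Theorems.CharDialJLinGroupCore
import HarnessLib

/-!
# Cell qa-qnc0 / decomp-qadv (odd primes): the PAIR-BLOCK witness family — inside part 5's core class, light for the CODE dial, and hard

TREE-READY PART 11 of the node `HOME/decomp-qadv-lens-6/g10/CodeDial.lean` (§25), on top of part 9.  `n = 8·L·m` inputs; `2m`
active cuts in pairs sharing a block of `4L` even positions; every active cut reads EVERY odd position (coefficient 1), so every
cut's PRIVATE set is EMPTY (`pairWitness_isCore`: an `L'`-core for every `L' ≥ 1` — the one-cut peeling law of part 4 is vacuous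
on it) and every adjacent pair is read by all active cuts; cut `2j` has coefficient 1 on its block's even positions, cut `2j+1`
coefficient 2 on the upper half; tables `[s = 0]`, no juntas (`p ∉ {2,3}`).  Kernel facts: `pairGroup_mem_lightGroups` (each pair is a
LIGHT group: private words have weight `≥ 2L = L·|G|`), `pairWitness_lightCover`, `pairWitness_lightGroups_ne_empty` (so group-cores
⊊ cores), and **`pairWitness_loses`** — by part 9's `lightCover_hard` the family LOSES α's u-walk game:
`∃ C' θ<1 n₀, 8Lm ≥ n₀ → C'·log₂(8Lm) ≤ L → #win ≤ θ·2^(8Lm)` for every charge `c`.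
-/

noncomputable section

namespace Summit.QuantumAdvantage.AdviceFreeQNC0.JLinPeel

open Finset Summit.QuantumAdvantage.AdviceFreeQNC0 TwistedTransfer JLinData

/-! ### §25 The PAIR-BLOCK witness family (kernel-built): inside g9's residual class, light for the CODE dial

`n = 8·L·m` inputs; cuts `g < 2m` ACTIVE in PAIRS `{2j, 2j+1}` sharing block `j` = positions `[8Lj, 8L(j+1))` (its `4L` even
positions); junta `∅`; every active cut reads EVERY odd position with coefficient `1`; on the even positions of its block cut `2j`
has coefficient `1`, cut `2j+1` has `1` on the first half (`i mod 8L < 4L`) and `2` on the second half; cuts `g ≥ 2m` are silent;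
tables `[s = 0]`.  EVERY ACTIVE CUT HAS ZERO PRIVATE BITS (its partner reads everything it reads: `pairWitness_isCore` — the family is an
`L'`-core for EVERY `L' ≥ 1`, so g9's single-cut peel cannot even start: cost `3p·ρ⁰·2ⁿ`), yet every pair is a LIGHT GROUP: the
private code of the pair on its `4L` block positions is `{(t+t')·𝟙_{first half} + (t+2t')·𝟙_{second half}}`, of minimum weight `2L = L·|G|`
(`pairGroup_mem_lightGroups`), the pairs cover (`pairWitness_lightCover`), so the family is NOT a group-core (`pairWitness_lightGroups_ne_empty`)
and LOSES by the proved rung (`pairWitness_loses`).  It has `2m = n/(4L)` active pairwise-coupled forms (rank `≫ √n` for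
`L = C'·log₂ n`: outside (W2)/27290 and `ShotsSqrtOdd`), every adjacent bit pair is read by all `2m` active cuts (outside R8, inside
23109's class), its light words have weight `2L ≪ n/2` in the global span (outside R11° `walkHardFLinFormsCode`), free tables. -/

section PairWitness

variable (p : ℕ)
/-- Coefficient of cut `g` at position `i` in the pair-block family. -/
def pairA (L m : ℕ) (g : Fin (8 * L * m + 1)) (i : Fin (8 * L * m)) : ZMod p :=
  if g.val < 2 * m ∧ i.val % 2 = 1 then 1
  else if g.val < 2 * m ∧ i.val % 2 = 0 ∧ i.val / (8 * L) = g.val / 2 then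
    (if g.val % 2 = 1 ∧ 4 * L ≤ i.val % (8 * L) then 2 else 1)
  else 0
/-- The pair-block data (junta-free linear tests `[ℓ_g(u) = 0]` for `g < 2m`, silent cuts for `g ≥ 2m`). -/
def pairWitness (L m : ℕ) : JLinData p (8 * L * m) where
  J := fun _ => ∅
  a := pairA p L m
  h := fun g _ s => decide (g.val < 2 * m ∧ s = 0)
  hJ := fun _ _ _ _ _ => rfl

variable {p}
/-- CharDial sub-characteristic helper `pairWitness_juntaBound` (lens-6 g8 LAND package; see the module docstring). -/
theorem pairWitness_juntaBound (L m : ℕ) : ∀ g, ((pairWitness p L m).J g).card ≤ 0 := fun g => by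
  show (∅ : Finset (Fin (8 * L * m))).card ≤ 0
  simp
/-- CharDial sub-characteristic helper `two_ne_zero_of_ne_two` (lens-6 g8 LAND package; see the module docstring). -/
theorem two_ne_zero_of_ne_two [Fact p.Prime] (hp2 : p ≠ 2) : (2 : ZMod p) ≠ 0 := by
  intro h
  have h' : ((2 : ℕ) : ZMod p) = 0 := by exact_mod_cast h
  rw [ZMod.natCast_eq_zero_iff] at h'
  exact hp2 ((Nat.prime_dvd_prime_iff_eq (Fact.out : p.Prime) Nat.prime_two).1 h')

section Values

variable {L m : ℕ}
/-- CharDial sub-characteristic helper `pairA_eq_zero_of_ge` (lens-6 g8 LAND package; see the module docstring). -/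
theorem pairA_eq_zero_of_ge {g : Fin (8 * L * m + 1)} (hg : ¬ g.val < 2 * m) (i : Fin (8 * L * m)) :
    pairA p L m g i = 0 := by
  unfold pairA
  rw [if_neg (fun h => hg h.1), if_neg (fun h => hg h.1)]
/-- CharDial sub-characteristic helper `pairA_odd` (lens-6 g8 LAND package; see the module docstring). -/
theorem pairA_odd {g : Fin (8 * L * m + 1)} (hg : g.val < 2 * m) {i : Fin (8 * L * m)} (hi : i.val % 2 = 1) :
    pairA p L m g i = 1 := by
  unfold pairA
  rw [if_pos ⟨hg, hi⟩]
/-- CharDial sub-characteristic helper `pairA_block` (lens-6 g8 LAND package; see the module docstring). -/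
theorem pairA_block {g : Fin (8 * L * m + 1)} (hg : g.val < 2 * m) {i : Fin (8 * L * m)} (hi0 : i.val % 2 = 0)
    (hblk : i.val / (8 * L) = g.val / 2) :
    pairA p L m g i = if g.val % 2 = 1 ∧ 4 * L ≤ i.val % (8 * L) then 2 else 1 := by
  unfold pairA
  rw [if_neg (fun h => by have := h.2; omega), if_pos ⟨hg, hi0, hblk⟩]
/-- CharDial sub-characteristic helper `pairA_block_ne_zero` (lens-6 g8 LAND package; see the module docstring). -/
theorem pairA_block_ne_zero [Fact p.Prime] (h2 : (2 : ZMod p) ≠ 0) {g : Fin (8 * L * m + 1)} (hg : g.val < 2 * m)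
    {i : Fin (8 * L * m)} (hi0 : i.val % 2 = 0) (hblk : i.val / (8 * L) = g.val / 2) : pairA p L m g i ≠ 0 := by
  rw [pairA_block hg hi0 hblk]
  split_ifs
  · exact h2
  · exact one_ne_zero
/-- CharDial sub-characteristic helper `pairA_ne_zero_imp` (lens-6 g8 LAND package; see the module docstring). -/
theorem pairA_ne_zero_imp {g : Fin (8 * L * m + 1)} {i : Fin (8 * L * m)} (h : pairA p L m g i ≠ 0) :
    g.val < 2 * m ∧ (i.val % 2 = 1 ∨ (i.val % 2 = 0 ∧ i.val / (8 * L) = g.val / 2)) := by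
  unfold pairA at h
  by_cases h1 : g.val < 2 * m ∧ i.val % 2 = 1
  · exact ⟨h1.1, Or.inl h1.2⟩
  · rw [if_neg h1] at h
    by_cases h2 : g.val < 2 * m ∧ i.val % 2 = 0 ∧ i.val / (8 * L) = g.val / 2
    · exact ⟨h2.1, Or.inr h2.2⟩
    · rw [if_neg h2] at h
      exact absurd rfl h

/-- If cut `g` reads position `i`, so does every cut `g' < 2m` of the same pair. -/
theorem pairA_ne_zero_of_samePair [Fact p.Prime] (h2 : (2 : ZMod p) ≠ 0) {g g' : Fin (8 * L * m + 1)} {i : Fin (8 * L * m)}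
    (h : pairA p L m g i ≠ 0) (hg' : g'.val < 2 * m) (hpair : g'.val / 2 = g.val / 2) : pairA p L m g' i ≠ 0 := by
  obtain ⟨_, hodd | ⟨hi0, hblk⟩⟩ := pairA_ne_zero_imp h
  · rw [pairA_odd hg' hodd]; exact one_ne_zero
  · exact pairA_block_ne_zero h2 hg' hi0 (hblk.trans hpair.symm)

/-- CharDial sub-characteristic helper `blockPos_lt` (lens-6 g8 LAND package; see the module docstring). -/
theorem blockPos_lt {j : ℕ} (hj : j < m) {r : ℕ} (hr : r < 8 * L) : 8 * L * j + r < 8 * L * m := by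
  have h1 : 8 * L * j + r < 8 * L * (j + 1) := by nlinarith
  have h2 : 8 * L * (j + 1) ≤ 8 * L * m := Nat.mul_le_mul_left _ hj
  omega

/-- CharDial sub-characteristic helper `blockPos_mod_two` (lens-6 g8 LAND package; see the module docstring). -/
theorem blockPos_mod_two (j r : ℕ) : (8 * L * j + r) % 2 = r % 2 := by
  have : 8 * L * j + r = 2 * (4 * L * j) + r := by ring
  rw [this, Nat.mul_add_mod]

/-- CharDial sub-characteristic helper `blockPos_div` (lens-6 g8 LAND package; see the module docstring). -/
theorem blockPos_div (hL : 0 < L) (j : ℕ) {r : ℕ} (hr : r < 8 * L) : (8 * L * j + r) / (8 * L) = j := by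
  rw [Nat.mul_add_div (by omega) j r, Nat.div_eq_of_lt hr, add_zero]

/-- CharDial sub-characteristic helper `blockPos_mod` (lens-6 g8 LAND package; see the module docstring). -/
theorem blockPos_mod (j : ℕ) {r : ℕ} (hr : r < 8 * L) : (8 * L * j + r) % (8 * L) = r := by
  rw [Nat.mul_add_mod, Nat.mod_eq_of_lt hr]

/-- CharDial sub-characteristic helper `two_m_le` (lens-6 g8 LAND package; see the module docstring). -/
theorem two_m_le (hL : 0 < L) : 2 * m ≤ 8 * L * m := by
  have h8 : 8 * 1 * m ≤ 8 * L * m := Nat.mul_le_mul_right m (Nat.mul_le_mul_left 8 hL)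
  omega

/-- An active cut of the pair-block family has index `< 2m`. -/
theorem pairWitness_lt_of_active [Fact p.Prime] {g : Fin (8 * L * m + 1)}
    (hg : ((pairWitness p L m).suppForm g).Nonempty) : g.val < 2 * m := by
  by_contra hlt
  obtain ⟨i, hi⟩ := hg
  unfold JLinData.suppForm pairWitness at hi
  simp only [mem_filter, mem_univ, true_and] at hi
  exact hi (pairA_eq_zero_of_ge hlt i)

/-- The data live on `n = 8Lm > 0` inputs as soon as some cut is active; in particular `L ≥ 1`. -/
theorem pos_of_active [Fact p.Prime] {g : Fin (8 * L * m + 1)} (hg : ((pairWitness p L m).suppForm g).Nonempty) : 0 < L := by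
  rcases Nat.eq_zero_or_pos L with h | h
  · subst h
    obtain ⟨i, _⟩ := hg
    exact absurd i.isLt (by simp)
  · exact h

/-- Every cut `g < 2m` is active (`L ≥ 1`, `p ≠ 2`). -/
theorem pairWitness_active [Fact p.Prime] (h2 : (2 : ZMod p) ≠ 0) (hL : 0 < L) {g : Fin (8 * L * m + 1)}
    (hg : g.val < 2 * m) : ((pairWitness p L m).suppForm g).Nonempty := by
  have hj : g.val / 2 < m := by omega
  refine ⟨⟨8 * L * (g.val / 2) + 0, blockPos_lt hj (by omega)⟩, ?_⟩
  unfold JLinData.suppForm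
  simp only [mem_filter, mem_univ, true_and]
  show pairA p L m g _ ≠ 0
  exact pairA_block_ne_zero h2 hg (by show (8 * L * (g.val / 2) + 0) % 2 = 0; rw [blockPos_mod_two])
    (by show (8 * L * (g.val / 2) + 0) / (8 * L) = g.val / 2; exact blockPos_div hL _ (by omega))

/-- Every active cut reads EVERY odd position (all `2m` active cuts read every adjacent bit pair: outside R8's hypothesis). -/
theorem pairWitness_odd_mem_suppForm [Fact p.Prime] {g : Fin (8 * L * m + 1)} (hg : g.val < 2 * m)
    (i : Fin (8 * L * m)) (hi : i.val % 2 = 1) : i ∈ (pairWitness p L m).suppForm g := by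
  unfold JLinData.suppForm
  simp only [mem_filter, mem_univ, true_and]
  show pairA p L m g i ≠ 0
  rw [pairA_odd hg hi]
  exact one_ne_zero

/-- **The pair-block family is an `L'`-core for EVERY `L' ≥ 1`** (g9's residual class): no active cut has a private bit, because its
partner reads everything it reads. -/
theorem pairWitness_isCore [Fact p.Prime] (h2 : (2 : ZMod p) ≠ 0) (L m : ℕ) {L' : ℕ} (hL' : 0 < L') :
    ∀ g, ((pairWitness p L m).suppForm g).Nonempty → (pairWitness p L m).priv g < L' := by
  intro g hg
  have hgm : g.val < 2 * m := pairWitness_lt_of_active hg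
  have hL : 0 < L := pos_of_active hg
  -- the partner cut
  set q : ℕ := if g.val % 2 = 0 then g.val + 1 else g.val - 1 with hq
  have hq2m : q < 2 * m := by rw [hq]; split_ifs <;> omega
  have hqg : q / 2 = g.val / 2 := by rw [hq]; split_ifs <;> omega
  have hqne : q ≠ g.val := by rw [hq]; split_ifs <;> omega
  have hqN : q < 8 * L * m + 1 := by have := two_m_le (m := m) hL; omega
  set g' : Fin (8 * L * m + 1) := ⟨q, hqN⟩ with hg'
  by_contra hlt
  push Not at hlt
  unfold JLinData.priv at hlt
  obtain ⟨i, hi⟩ := card_pos.1 (lt_of_lt_of_le hL' hlt)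
  unfold JLinData.privSet at hi
  rw [mem_filter] at hi
  obtain ⟨hsupp, _, hothers⟩ := hi
  have hne : g' ≠ g := fun h => hqne (by rw [← h])
  apply hothers g' hne
  unfold JLinData.readSet
  rw [mem_union]
  right
  unfold JLinData.suppForm at hsupp ⊢
  rw [mem_filter] at hsupp ⊢
  refine ⟨mem_univ _, ?_⟩
  show pairA p L m g' i ≠ 0
  exact pairA_ne_zero_of_samePair h2 hsupp.2 hq2m hqg

/-! The light pairs. -/

/-- The lower / upper cut of pair `j`. -/
def pairLo (hL : 0 < L) {j : ℕ} (hj : j < m) : Fin (8 * L * m + 1) :=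
  ⟨2 * j, by have := two_m_le (m := m) hL; omega⟩

/-- The upper cut of pair `j`. -/
def pairHi (hL : 0 < L) {j : ℕ} (hj : j < m) : Fin (8 * L * m + 1) :=
  ⟨2 * j + 1, by have := two_m_le (m := m) hL; omega⟩

/-- Pair `j` as a group of cuts. -/
def pairGroup (hL : 0 < L) {j : ℕ} (hj : j < m) : Finset (Fin (8 * L * m + 1)) := {pairLo hL hj, pairHi hL hj}

/-- CharDial sub-characteristic helper `pairLo_ne_pairHi` (lens-6 g8 LAND package; see the module docstring). -/
theorem pairLo_ne_pairHi (hL : 0 < L) {j : ℕ} (hj : j < m) : pairLo hL hj ≠ pairHi hL hj := by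
  intro h
  have h' := congrArg Fin.val h
  change 2 * j = 2 * j + 1 at h'
  omega

/-- CharDial sub-characteristic helper `mem_pairGroup_iff` (lens-6 g8 LAND package; see the module docstring). -/
theorem mem_pairGroup_iff (hL : 0 < L) {j : ℕ} (hj : j < m) {g : Fin (8 * L * m + 1)} :
    g ∈ pairGroup hL hj ↔ g.val / 2 = j := by
  unfold pairGroup
  rw [mem_insert, mem_singleton]
  constructor
  · rintro (rfl | rfl)
    · show 2 * j / 2 = j; omega
    · show (2 * j + 1) / 2 = j; omega
  · intro h
    rcases Nat.mod_two_eq_zero_or_one g.val with h0 | h1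
    · left; exact Fin.ext (by show g.val = 2 * j; omega)
    · right; exact Fin.ext (by show g.val = 2 * j + 1; omega)

/-- The even positions of block `j` are GROUP-PRIVATE to pair `j`. -/
theorem blockPos_mem_gPrivSet [Fact p.Prime] (hL : 0 < L) {j : ℕ} (hj : j < m) {r : ℕ} (hr : r < 8 * L) (hr2 : r % 2 = 0) :
    (⟨8 * L * j + r, blockPos_lt hj hr⟩ : Fin (8 * L * m)) ∈ (pairWitness p L m).gPrivSet (pairGroup hL hj) := by
  unfold JLinData.gPrivSet
  rw [mem_filter]
  refine ⟨mem_univ _, fun g' => ?_, fun g' hg' => ?_⟩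
  · show _ ∉ (∅ : Finset (Fin (8 * L * m)))
    simp
  · by_contra hne
    have himp := pairA_ne_zero_imp (p := p) (L := L) (m := m) hne
    have hi2 : (8 * L * j + r) % 2 = 0 := by rw [blockPos_mod_two, hr2]
    rcases himp.2 with hodd | ⟨_, hblk⟩
    · have hodd' : (8 * L * j + r) % 2 = 1 := hodd
      omega
    · have hblk' : (8 * L * j + r) / (8 * L) = g'.val / 2 := hblk
      rw [blockPos_div hL j hr] at hblk'
      exact hg' ((mem_pairGroup_iff hL hj).2 hblk'.symm)

/-- The twist vector of pair `j` at block position `8Lj + r`: `t_lo + t_hi·(1 or 2)` according to the half. -/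
theorem twistVec_pair_blockPos [Fact p.Prime] (hL : 0 < L) {j : ℕ} (hj : j < m) {r : ℕ} (hr : r < 8 * L) (hr2 : r % 2 = 0)
    (t : Fin (8 * L * m + 1) → ZMod p) :
    (pairWitness p L m).twistVec (pairGroup hL hj) t ⟨8 * L * j + r, blockPos_lt hj hr⟩ =
      t (pairLo hL hj) + t (pairHi hL hj) * (if 4 * L ≤ r then 2 else 1) := by
  unfold JLinData.twistVec pairGroup
  rw [Finset.sum_pair (pairLo_ne_pairHi hL hj)]
  have hi2 : (8 * L * j + r) % 2 = 0 := by rw [blockPos_mod_two, hr2]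
  have hdiv : (8 * L * j + r) / (8 * L) = j := blockPos_div hL j hr
  have hlo : (pairWitness p L m).a (pairLo hL hj) ⟨8 * L * j + r, blockPos_lt hj hr⟩ = 1 := by
    show pairA p L m (pairLo hL hj) _ = 1
    rw [pairA_block (by show 2 * j < 2 * m; omega) hi2 (by rw [hdiv]; show j = 2 * j / 2; omega)]
    rw [if_neg]
    rintro ⟨h, _⟩
    have h' : 2 * j % 2 = 1 := h
    omega
  have hhi : (pairWitness p L m).a (pairHi hL hj) ⟨8 * L * j + r, blockPos_lt hj hr⟩ = if 4 * L ≤ r then 2 else 1 := by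
    show pairA p L m (pairHi hL hj) _ = _
    rw [pairA_block (by show 2 * j + 1 < 2 * m; omega) hi2 (by rw [hdiv]; show j = (2 * j + 1) / 2; omega)]
    have hmod : (8 * L * j + r) % (8 * L) = r := blockPos_mod j hr
    have hpar : (2 * j + 1) % 2 = 1 := by omega
    by_cases h4 : 4 * L ≤ r
    · rw [if_pos h4, if_pos ⟨hpar, by show 4 * L ≤ (8 * L * j + r) % (8 * L); rw [hmod]; exact h4⟩]
    · rw [if_neg h4, if_neg (fun h => h4 (by have := h.2; rw [show (8 * L * j + r) % (8 * L) = r from hmod] at this; exact this))]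
  rw [hlo, hhi, mul_one]

/-- One HALF of block `j` (offset `o = 0` or `o = 4L`) on which the twist vector is a nonzero constant gives private weight `≥ 2L`. -/
theorem privWt_pair_ge [Fact p.Prime] (hL : 0 < L) {j : ℕ} (hj : j < m) (t : Fin (8 * L * m + 1) → ZMod p) (b : Bool)
    (hc : t (pairLo hL hj) + t (pairHi hL hj) * (if b then 2 else 1) ≠ 0) :
    2 * L ≤ (pairWitness p L m).privWt (pairGroup hL hj) t := by
  classical
  set o : ℕ := if b then 4 * L else 0 with ho
  have ho4 : o ≤ 4 * L := by rw [ho]; split_ifs <;> omega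
  have ho2 : o % 2 = 0 := by rw [ho]; split_ifs <;> omega
  have hr : ∀ s : Fin (2 * L), o + 2 * s.val < 8 * L := fun s => by have := s.isLt; omega
  have hr2 : ∀ s : Fin (2 * L), (o + 2 * s.val) % 2 = 0 := fun s => by omega
  let f : Fin (2 * L) → Fin (8 * L * m) := fun s => ⟨8 * L * j + (o + 2 * s.val), blockPos_lt hj (hr s)⟩
  have hf : Function.Injective f := by
    intro s s' h
    have := congrArg Fin.val h
    simp only [f] at this
    exact Fin.ext (by omega)
  have hhalf : ∀ s : Fin (2 * L), (4 * L ≤ o + 2 * s.val ↔ b = true) := by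
    intro s
    have := s.isLt
    cases b
    · have ho0 : o = 0 := by rw [ho]; simp
      rw [ho0]
      simp only [Bool.false_eq_true, iff_false, not_le]
      omega
    · have ho1 : o = 4 * L := by rw [ho]; simp
      rw [ho1]
      simp only [iff_true]
      omega
  have hsub : univ.image f ⊆ ((pairWitness p L m).gPrivSet (pairGroup hL hj)).filter
      (fun i => (pairWitness p L m).twistVec (pairGroup hL hj) t i ≠ 0) := by
    intro i hi
    obtain ⟨s, _, rfl⟩ := mem_image.1 hi
    rw [mem_filter]
    refine ⟨blockPos_mem_gPrivSet hL hj (hr s) (hr2 s), ?_⟩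
    show (pairWitness p L m).twistVec (pairGroup hL hj) t ⟨8 * L * j + (o + 2 * s.val), blockPos_lt hj (hr s)⟩ ≠ 0
    rw [twistVec_pair_blockPos hL hj (hr s) (hr2 s) t]
    have hiff := hhalf s
    cases b
    · rw [if_neg (fun h => by rw [hiff] at h; exact Bool.false_ne_true h)]
      simpa using hc
    · rw [if_pos (hiff.2 rfl)]
      simpa using hc
  unfold JLinData.privWt
  calc 2 * L = (univ.image f).card := by rw [card_image_of_injective _ hf]; simp
    _ ≤ _ := card_le_card hsub

/-- **Pair `j` is a LIGHT group** (private minimum weight `2L = L·|pair|`). -/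
theorem pairGroup_mem_lightGroups [Fact p.Prime] (h2 : (2 : ZMod p) ≠ 0) (hL : 0 < L) {j : ℕ} (hj : j < m) :
    pairGroup hL hj ∈ (pairWitness p L m).lightGroups L := by
  classical
  rw [mem_lightGroups]
  have hne := pairLo_ne_pairHi hL hj
  refine ⟨⟨pairLo hL hj, by unfold pairGroup; exact mem_insert_self _ _⟩, ?_, fun t ht ht0 => ?_⟩
  · intro g hg
    rw [mem_activeSet]
    have hg2 := (mem_pairGroup_iff hL hj).1 hg
    exact pairWitness_active h2 hL (by omega)
  · have hcard : (pairGroup hL hj).card = 2 := by unfold pairGroup; exact card_pair hne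
    rw [hcard]
    -- the two coefficients are not both zero
    have hcoef : t (pairLo hL hj) + t (pairHi hL hj) * (if false then 2 else 1) ≠ 0 ∨
        t (pairLo hL hj) + t (pairHi hL hj) * (if true then 2 else 1) ≠ 0 := by
      simp only [if_true, mul_one, Bool.false_eq_true, if_false]
      by_contra hboth
      push Not at hboth
      have hO : t (pairHi hL hj) = 0 := by
        calc t (pairHi hL hj) = (t (pairLo hL hj) + t (pairHi hL hj) * 2) - (t (pairLo hL hj) + t (pairHi hL hj)) := by ring
          _ = 0 := by rw [hboth.1, hboth.2, sub_zero]
      have hE : t (pairLo hL hj) = 0 := by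
        have := hboth.1
        rw [hO, add_zero] at this
        exact this
      apply ht0
      funext g
      by_cases hg : g ∈ pairGroup hL hj
      · unfold pairGroup at hg
        rw [mem_insert, mem_singleton] at hg
        rcases hg with rfl | rfl
        · exact hE
        · exact hO
      · exact mem_tSet.1 ht g hg
    rcases hcoef with h | h
    · have := privWt_pair_ge hL hj t false h; omega
    · have := privWt_pair_ge hL hj t true h; omega


/-- **The pairs form a LIGHT COVER** of the pair-block family. -/
theorem pairWitness_lightCover [Fact p.Prime] (h2 : (2 : ZMod p) ≠ 0) (L m : ℕ) :
    ∀ g ∈ (pairWitness p L m).activeSet, ∃ G ∈ (pairWitness p L m).lightGroups L, g ∈ G := by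
  intro g hg
  rw [mem_activeSet] at hg
  have hgm : g.val < 2 * m := pairWitness_lt_of_active hg
  have hL : 0 < L := pos_of_active hg
  have hj : g.val / 2 < m := by omega
  exact ⟨pairGroup hL hj, pairGroup_mem_lightGroups h2 hL hj, (mem_pairGroup_iff hL hj).2 rfl⟩

/-- **The pair-block family is NOT a group-core** (`L, m ≥ 1`): g10's residual class is strictly smaller than g9's. -/
theorem pairWitness_lightGroups_ne_empty [Fact p.Prime] (h2 : (2 : ZMod p) ≠ 0) (hL : 0 < L) (hm : 0 < m) :
    (pairWitness p L m).lightGroups L ≠ ∅ :=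
  fun h => not_mem_of_lightGroups_eq_empty _ h _ (pairGroup_mem_lightGroups h2 hL hm)

end Values

/-- **The rung in action (a THEOREM, no hypothesis)**: pair-block members with `L ≥ C'·log₂ n` lose the u-walk game for every prime
`p ∉ {2, 3}` — although every one of their cuts has ZERO private bits (g9's law is silent on them and they lie inside g9's residual
core class), and no proved rung of the lineage covers them for `p ≥ 7`. -/
theorem pairWitness_loses [Fact p.Prime] (hp2 : p ≠ 2) (hp3 : p ≠ 3) :
    ∃ C' : ℕ, ∃ θ : ℝ, θ < 1 ∧ ∃ n₀ : ℕ, ∀ L m : ℕ, n₀ ≤ 8 * L * m → C' * Nat.log 2 (8 * L * m) ≤ L → ∀ c : ℕ,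
      (winCount c (pairWitness p L m).strat : ℝ) ≤ θ * (2 : ℝ) ^ (8 * L * m) := by
  obtain ⟨C', θ, hθ, n₀, hn₀⟩ := lightCover_hard p hp3
  refine ⟨C', θ, hθ, n₀, fun L m hn hL c => hn₀ _ hn c _ (fun g => ?_)
    (lightCover_mono _ (pairWitness_lightCover (two_ne_zero_of_ne_two hp2) L m) hL)⟩
  show (∅ : Finset (Fin (8 * L * m))).card ≤ _
  simp

end PairWitness

end Summit.QuantumAdvantage.AdviceFreeQNC0.JLinPeel

end
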